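import Summits.AtomisticToContinuum.HydrodynamicLimit.Theorems.InformationPercolationEngineLocalSecondLawOneBodyStaticsOnePt

/-!
# One-body statics of the canonical hard-sphere gas, uniformly over bounded observables, file 2:
the two-point expectation, the variance, and stub `stub_oneBodyStatics` (ML)

Stub `stub_oneBodyStatics` of line `contact-asymmetry-information` (skeleton v3) of the crux
`LocalSecondLaw` (item stmt-AtomisticToContinuum-13081; route InformationPercolationEngine, shared
with JParityClosure): the **uniform-in-`g` mean-square law of large numbers** of the empirical
measure of the configurational canonical hard-sphere gas `Ξ⁻¹ · (β dy)^{⊗(N+1)}|_{hard core}` at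
small reduced density (`SmallDensity P σ`):

  `∀ ε > 0, ∃ N₀, ∀ N ≥ N₀, ∀ g` measurable with `|g| ≤ 1`,
  `Ξ_N(N+1)⁻¹ ∫ ((N+1)⁻¹ ∑ᵢ g(xᵢ) - ∫ g ρ₀)² 𝟙[hard core] dμ^{⊗(N+1)} ≤ ε`, `ρ₀ = rhoLim P σ`

(`stub_oneBodyStatics`). The tree's `SmallDensity.tendsto_variance` is this for ONE continuous test
function; uniformity over the unit ball of observables comes from the uniform one-point limit of
file 1 (`onePt_uniform`) and, here,

* `twoPt_uniform`: `∀ δ > 0, ∀ᶠ N, ∀ g, |E_{N+1}[g(x₀) g(x₁)] - I(g)²| ≤ δ` — the two-point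
  decorated expansion in size form (`LGFS.twoPt_eq_sum_add`): head/tail split with the geometric
  majorant `(2e + 2e·2e/(1-θ)) θʲ`, termwise uniform limits (`twoPt_term_uniform`, from
  `coefN_uniform`, `onePt_uniform`, `tendsto_rN`), and the same-block remainder
  `≤ 4e² S p_{ε_N}` uniformly in `g` (`LGFS.abs_sameBlockRem_div_le_L1`, `∫ |g| dμ ≤ 1`);
* `variance_uniform`: the variance identity of `HardSphereEulerLLN` centred at
  `I(g) = ∫ g ρ₀` (`Ilim_eq_integral_of_measurable`), with `|E[g²]| ≤ 1`, `|I(g)| ≤ 2e/(1-θ)`.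

References: H. Spohn, *Large Scale Dynamics of Interacting Particles* (1991), Part I §2.3
(2.45)–(2.46); E. Pulvirenti, D. Tsagkarogiannis, Comm. Math. Phys. 316 (2012) §3–5.
-/

noncomputable section

namespace Summit.AtomisticToContinuum.HydrodynamicLimit.Theorems
namespace LocalSecondLawOneBodyStatics
open MeasureTheory Finset Filter Topology
open Literature.Probability.LatticeModels Literature.MathematicalPhysics.StatisticalMechanics
  Literature.MathematicalPhysics.KineticTheory
open scoped ENNReal

variable {P : DensityProfile} {σ : ℝ}

/-! ### The two-point expansion: termwise bound and termwise uniform limit -/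

/-- **Termwise bound for the two-point expansion**: for `|g| ≤ 1` measurable and `j < N`,
`|C(N-1,j) W^g(j+1) E_{N-j}[g] r_N(N+1,j+1)| ≤ 2e θʲ` (sup-norm tree bound, `|E[g]| ≤ 1`,
`r ≤ 2^{j+1}`). -/
theorem abs_twoPt_term_le (hs : SmallDensity P σ) {g : T3 → ℝ} (hgm : Measurable g)
    (hg1 : ∀ y, |g y| ≤ 1) {N j : ℕ} (hj : j < N) :
    |coefN P σ N g (N - 1) j * onePt P σ g N (j + 1) * rN P σ N (N + 1) (j + 1)| ≤
      2 * Real.exp 1 * geomRatio P σ ^ j := by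
  have hlam1 := hs.ovDensity_lt_one
  have hl0 := hs.ovDensity_nonneg
  have hco := abs_coefN_le (P := P) hs.σ_pos.le hs.σ_lt_half hgm hg1 (N := N) (m := N - 1) (j := j)
    (by omega) (by omega)
  have ho := hs.abs_onePt_le hgm hg1 N (j + 1)
  have hr0 : 0 ≤ rN P σ N (N + 1) (j + 1) :=
    zero_le_one.trans (one_le_rN hs.σ_pos.le hs.σ_lt_half hlam1 le_rfl (by omega))
  have hr2 := hs.rN_le_two_pow (N := N) (m := N + 1) (j := j + 1) le_rfl (by omega)
  rw [abs_mul, abs_mul, abs_of_nonneg hr0]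
  calc |coefN P σ N g (N - 1) j| * |onePt P σ g N (j + 1)| * rN P σ N (N + 1) (j + 1)
      ≤ (1 * (Real.exp 1 * (Real.exp 1 * ovDensity P σ) ^ j)) * 1 * 2 ^ (j + 1) :=
        mul_le_mul (mul_le_mul hco ho (abs_nonneg _) (by positivity)) hr2 hr0 (by positivity)
    _ = 2 * Real.exp 1 * geomRatio P σ ^ j := by rw [geomRatio]; ring

/-- **Termwise uniform limit for the two-point expansion**: for every `j`,
`∀ η > 0, ∀ᶠ N, ∀ g` measurable with `|g| ≤ 1`,
`|C(N-1,j) W^g(j+1) E_{N-j}[g] r_N(N+1,j+1) - γ_{j+1} (∫ g β^{j+1}) R^{j+1} I(g)| ≤ η`. -/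
theorem twoPt_term_uniform (hs : SmallDensity P σ) (j : ℕ) {η : ℝ} (hη : 0 < η) :
    ∀ᶠ N in atTop, ∀ g : T3 → ℝ, Measurable g → (∀ y, |g y| ≤ 1) →
      |coefN P σ N g (N - 1) j * onePt P σ g N (j + 1) * rN P σ N (N + 1) (j + 1) -
        coefLim P σ g j * ratioLimit P σ ^ (j + 1) * Ilim P σ g| ≤ η := by
  have hl0 := hs.ovDensity_nonneg
  have hθ0 := hs.geomRatio_nonneg
  have hθ1 := hs.geomRatio_lt_one
  set B := (1 : ℝ) * (Real.exp 1 * (Real.exp 1 * ovDensity P σ) ^ j) with hB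
  have hB0 : 0 ≤ B := by positivity
  set R := ratioLimit P σ with hR
  have hR0 : 0 ≤ R ^ (j + 1) := pow_nonneg hs.ratioLimit_pos.le _
  have hR2 : R ^ (j + 1) ≤ 2 ^ (j + 1) := pow_le_pow_left₀ hs.ratioLimit_pos.le hs.ratioLimit_mem.2 _
  set ρm := 2 * Real.exp 1 / (1 - geomRatio P σ) with hρm
  have hρm0 : 0 ≤ ρm := by rw [hρm]; exact div_nonneg (by positivity) (by linarith)
  -- small parameters: `|c - c∞| |o| r`, `|c∞| |o - I| r`, `|c∞ I| |r - R|`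
  obtain ⟨η₁, hη₁, hη₁le⟩ := LGFS.exists_pos_mul_le (ε := η / 3) (K := (1 : ℝ) * 2 ^ (j + 1))
    (by positivity) (by positivity)
  obtain ⟨η₂, hη₂, hη₂le⟩ := LGFS.exists_pos_mul_le (ε := η / 3) (K := B * 2 ^ (j + 1))
    (by positivity) (by positivity)
  obtain ⟨η₃, hη₃, hη₃le⟩ := LGFS.exists_pos_mul_le (ε := η / 3) (K := B * ρm) (by positivity)
    (by positivity)
  have hE1 := coefN_uniform hs 1 j hη₁
  have hE2 := onePt_uniform hs (j + 1) hη₂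
  have hE3 : ∀ᶠ N : ℕ in atTop, |rN P σ N (N + 1) (j + 1) - R ^ (j + 1)| ≤ η₃ := by
    have h := hs.tendsto_rN 0 (j + 1)
    simp only [Nat.sub_zero] at h
    rw [← hR] at h
    have h2 : Tendsto (fun N => |rN P σ N (N + 1) (j + 1) - R ^ (j + 1)|) atTop (𝓝 0) := by
      have := (h.sub_const (R ^ (j + 1))).abs
      rw [sub_self, abs_zero] at this
      exact this
    exact (h2.eventually (ge_mem_nhds hη₃)).mono fun N hN => hN
  have hE4 : ∀ᶠ N : ℕ in atTop, j + 1 ≤ N := eventually_ge_atTop _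
  filter_upwards [hE1, hE2, hE3, hE4] with N hN1 hN2 hN3 hN4 g hgm hg1
  have hlam1 := hs.ovDensity_lt_one
  -- the factors and their bounds
  set c := coefN P σ N g (N - 1) j with hc
  set o := onePt P σ g N (j + 1) with ho
  set rr := rN P σ N (N + 1) (j + 1) with hrr
  set cL := coefLim P σ g j with hcL
  set I := Ilim P σ g with hI
  have hco : |c| ≤ B :=
    abs_coefN_le (P := P) hs.σ_pos.le hs.σ_lt_half hgm hg1 (N := N) (m := N - 1) (j := j)
      (by omega) (by omega)
  have hoabs : |o| ≤ 1 := hs.abs_onePt_le hgm hg1 N (j + 1)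
  have hr0 : 0 ≤ rr := zero_le_one.trans (one_le_rN hs.σ_pos.le hs.σ_lt_half hlam1 le_rfl (by omega))
  have hr2 : rr ≤ 2 ^ (j + 1) := hs.rN_le_two_pow (N := N) (m := N + 1) (j := j + 1) le_rfl (by omega)
  have hcLle : |cL| ≤ B := abs_coefLim_le (P := P) hs.σ_pos hs.σ_lt_half hgm hg1 j
  have hIle : |I| ≤ ρm := abs_Ilim_le hs hgm hg1
  -- telescoping
  have hsplit : c * o * rr - cL * R ^ (j + 1) * I =
      (c - cL) * o * rr + cL * (o - I) * rr + cL * I * (rr - R ^ (j + 1)) := by ring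
  rw [hsplit]
  have hT1 : |(c - cL) * o * rr| ≤ η / 3 := by
    rw [abs_mul, abs_mul, abs_of_nonneg hr0]
    calc |c - cL| * |o| * rr ≤ η₁ * 1 * 2 ^ (j + 1) :=
          mul_le_mul (mul_le_mul (hN1 g hgm hg1) hoabs (abs_nonneg _) hη₁.le) hr2 hr0 (by positivity)
      _ = 1 * 2 ^ (j + 1) * η₁ := by ring
      _ ≤ η / 3 := hη₁le
  have hT2 : |cL * (o - I) * rr| ≤ η / 3 := by
    rw [abs_mul, abs_mul, abs_of_nonneg hr0]
    calc |cL| * |o - I| * rr ≤ B * η₂ * 2 ^ (j + 1) :=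
          mul_le_mul (mul_le_mul hcLle (hN2 g hgm hg1) (abs_nonneg _) hB0) hr2 hr0 (by positivity)
      _ = B * 2 ^ (j + 1) * η₂ := by ring
      _ ≤ η / 3 := hη₂le
  have hT3 : |cL * I * (rr - R ^ (j + 1))| ≤ η / 3 := by
    rw [abs_mul, abs_mul]
    calc |cL| * |I| * |rr - R ^ (j + 1)| ≤ B * ρm * η₃ :=
          mul_le_mul (mul_le_mul hcLle hIle (abs_nonneg _) hB0) hN3 (abs_nonneg _) (by positivity)
      _ ≤ η / 3 := hη₃le
  calc |(c - cL) * o * rr + cL * (o - I) * rr + cL * I * (rr - R ^ (j + 1))|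
      ≤ |(c - cL) * o * rr| + |cL * (o - I) * rr| + |cL * I * (rr - R ^ (j + 1))| :=
        abs_add_three _ _ _
    _ ≤ η / 3 + η / 3 + η / 3 := add_le_add_three hT1 hT2 hT3
    _ = η := by ring

/-! ### The two-point expectation, uniformly over the unit ball of observables -/

/-- **The uniform two-point limit**: `∀ δ > 0, ∀ᶠ N, ∀ g` measurable with `|g| ≤ 1`,
`|E_{N+1}[g(x₀) g(x₁)] - I(g)²| ≤ δ` (small density). -/
theorem twoPt_uniform (hs : SmallDensity P σ) {δ : ℝ} (hδ : 0 < δ) :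
    ∀ᶠ N in atTop, ∀ g : T3 → ℝ, Measurable g → (∀ y, |g y| ≤ 1) →
      |twoPt P σ g N - Ilim P σ g ^ 2| ≤ δ := by
  have hθ0 := hs.geomRatio_nonneg
  have hθ1 := hs.geomRatio_lt_one
  have hl0 := hs.ovDensity_nonneg
  set ρm := 2 * Real.exp 1 / (1 - geomRatio P σ) with hρm
  have hρm0 : 0 ≤ ρm := by rw [hρm]; exact div_nonneg (by positivity) (by linarith)
  -- a common geometric majorant `A θʲ` for the terms and for the limit terms
  set A := 2 * Real.exp 1 + 2 * Real.exp 1 * ρm with hA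
  have hA0 : 0 ≤ A := by positivity
  have htail : Tendsto (fun J : ℕ => A * geomRatio P σ ^ J / (1 - geomRatio P σ)) atTop (𝓝 0) := by
    have := ((tendsto_pow_atTop_nhds_zero_of_lt_one hθ0 hθ1).const_mul A).div_const
      (1 - geomRatio P σ)
    rw [mul_zero, zero_div] at this
    exact this
  obtain ⟨J, hJ⟩ := (htail.eventually (ge_mem_nhds (by positivity : (0 : ℝ) < δ / 5))).exists
  have hgeo : HasSum (fun i : ℕ => A * geomRatio P σ ^ J * geomRatio P σ ^ i)
      (A * geomRatio P σ ^ J / (1 - geomRatio P σ)) := by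
    have h := (hasSum_geometric_of_lt_one hθ0 hθ1).mul_left (A * geomRatio P σ ^ J)
    rwa [← div_eq_mul_inv] at h
  -- the head
  have hhead : ∀ᶠ N in atTop, ∀ j ∈ range J, ∀ g : T3 → ℝ, Measurable g → (∀ y, |g y| ≤ 1) →
      |coefN P σ N g (N - 1) j * onePt P σ g N (j + 1) * rN P σ N (N + 1) (j + 1) -
        coefLim P σ g j * ratioLimit P σ ^ (j + 1) * Ilim P σ g| ≤ δ / (5 * ((J : ℝ) + 1)) := by
    refine (Finset.eventually_all (range J)).2 fun j _ => ?_
    exact twoPt_term_uniform hs j (by positivity)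
  -- the same-block remainder: `4 e² S p_{ε_N} → 0`
  set S := geomRatio P σ / (1 - geomRatio P σ) ^ 2 + (1 - geomRatio P σ)⁻¹ with hS
  have hS0 : 0 ≤ S := hs.hasSum_succ_mul_geomRatio_pow.nonneg fun j => by positivity
  have hrem : ∀ᶠ N : ℕ in atTop, 4 * Real.exp 1 ^ 2 * S * pOv P (hsDiameter σ N) ≤ δ / 5 := by
    have h1 : Tendsto (fun N : ℕ => 4 * Real.exp 1 ^ 2 * S * (ovDensity P σ / ((N : ℝ) + 1)))
        atTop (𝓝 0) := by
      have h0 : Tendsto (fun N : ℕ => ovDensity P σ / ((N : ℝ) + 1)) atTop (𝓝 0) :=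
        tendsto_const_nhds.div_atTop (tendsto_natCast_atTop_atTop.atTop_add tendsto_const_nhds)
      have := h0.const_mul (4 * Real.exp 1 ^ 2 * S)
      rw [mul_zero] at this
      exact this
    refine (h1.eventually (ge_mem_nhds (by positivity : (0 : ℝ) < δ / 5))).mono fun N hN => ?_
    refine le_trans (le_of_eq ?_) hN
    rw [pOv_hsDiameter]; push_cast; ring
  have hE : ∀ᶠ N : ℕ in atTop, J + 1 ≤ N := eventually_ge_atTop _
  filter_upwards [hhead, hrem, hE] with N hN hNrem hNJ g hgm hg1
  have hIa : ∫ y, |g y| ∂P.μ ≤ 1 := integral_abs_μ_le_one hg1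
  have h2 : 2 ≤ N + 1 := by omega
  -- names
  set G : ℕ → ℝ := fun j =>
    coefN P σ N g (N - 1) j * onePt P σ g N (j + 1) * rN P σ N (N + 1) (j + 1) with hG
  set T : ℕ → ℝ := fun j => coefLim P σ g j * ratioLimit P σ ^ (j + 1) * Ilim P σ g with hT
  have hGle : ∀ j, j < N → |G j| ≤ A * geomRatio P σ ^ j := fun j hj => by
    refine (abs_twoPt_term_le hs hgm hg1 hj).trans ?_
    rw [hA, add_mul]
    have : 0 ≤ 2 * Real.exp 1 * ρm * geomRatio P σ ^ j := by positivity
    linarith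
  have hTle : ∀ j, |T j| ≤ A * geomRatio P σ ^ j := fun j => by
    have h1 := hs.abs_Ilim_term_le hgm hg1 j
    have h2 := abs_Ilim_le hs hgm hg1
    rw [hT]; dsimp only
    rw [abs_mul]
    calc |coefLim P σ g j * ratioLimit P σ ^ (j + 1)| * |Ilim P σ g|
        ≤ (2 * 1 * Real.exp 1 * geomRatio P σ ^ j) * ρm := mul_le_mul h1 h2 (abs_nonneg _) (by positivity)
      _ ≤ A * geomRatio P σ ^ j := by
          rw [hA, add_mul]
          have : 0 ≤ 2 * Real.exp 1 * geomRatio P σ ^ j := by positivity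
          nlinarith
  -- the expansions
  have hexp : twoPt P σ g N = ∑ j ∈ range J, G j + ∑ j ∈ Ico J N, G j +
      sameBlockRem P (hsDiameter σ N) (N + 1) h2 g g / XiN P σ N (N + 1) := by
    rw [LGFS.twoPt_eq_sum_add hs hgm hg1 h2, Finset.sum_range_add_sum_Ico _ (show J ≤ N by omega)]
  have hsumT : Summable T := by
    refine Summable.of_norm_bounded ((summable_geometric_of_lt_one hθ0 hθ1).mul_left A) fun j => ?_
    rw [Real.norm_eq_abs]; exact hTle j
  have hlim : Ilim P σ g ^ 2 = ∑ j ∈ range J, T j + ∑' j, T (j + J) := by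
    rw [hsumT.sum_add_tsum_nat_add J]
    simp only [hT]
    rw [tsum_mul_right, ← Ilim, sq]
  rw [hexp, hlim]
  -- the pieces
  have h1 : |∑ j ∈ range J, G j - ∑ j ∈ range J, T j| ≤ δ / 5 := by
    rw [← sum_sub_distrib]
    calc |∑ j ∈ range J, (G j - T j)| ≤ ∑ j ∈ range J, |G j - T j| := abs_sum_le_sum_abs _ _
      _ ≤ ∑ _j ∈ range J, δ / (5 * ((J : ℝ) + 1)) := sum_le_sum fun j hj => hN j hj g hgm hg1
      _ = J * (δ / (5 * ((J : ℝ) + 1))) := by rw [sum_const, card_range, nsmul_eq_mul]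
      _ ≤ δ / 5 := by
          rw [mul_div_assoc', div_le_div_iff₀ (by positivity) (by positivity)]
          nlinarith
  have h2' : |∑ j ∈ Ico J N, G j| ≤ δ / 5 := by
    calc |∑ j ∈ Ico J N, G j| ≤ ∑ j ∈ Ico J N, |G j| := abs_sum_le_sum_abs _ _
      _ ≤ ∑ j ∈ Ico J N, A * geomRatio P σ ^ j := sum_le_sum fun j hj => hGle j (mem_Ico.1 hj).2
      _ = ∑ i ∈ range (N - J), A * geomRatio P σ ^ J * geomRatio P σ ^ i := by
          rw [sum_Ico_eq_sum_range]
          refine sum_congr rfl fun i _ => ?_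
          rw [pow_add]; ring
      _ ≤ A * geomRatio P σ ^ J / (1 - geomRatio P σ) := sum_le_hasSum _ (fun i _ => by positivity) hgeo
      _ ≤ δ / 5 := hJ
  have h3 : |∑' j, T (j + J)| ≤ δ / 5 := by
    refine le_trans ?_ hJ
    refine (Real.norm_eq_abs _).symm.trans_le (tsum_of_norm_bounded hgeo fun i => ?_)
    rw [Real.norm_eq_abs]
    calc |T (i + J)| ≤ A * geomRatio P σ ^ (i + J) := hTle (i + J)
      _ = A * geomRatio P σ ^ J * geomRatio P σ ^ i := by rw [pow_add]; ring
  have h4 : |sameBlockRem P (hsDiameter σ N) (N + 1) h2 g g / XiN P σ N (N + 1)| ≤ δ / 5 := by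
    refine (LGFS.abs_sameBlockRem_div_le_L1 hs hgm hgm hg1 hg1 N h2).trans (le_trans ?_ hNrem)
    have hp0 : 0 ≤ pOv P (hsDiameter σ N) := pOv_nonneg P (hsDiameter_nonneg' hs.σ_pos.le N)
    have hI1 : (∫ y, |g y| ∂P.μ) * 1 ≤ 1 := by rw [mul_one]; exact hIa
    calc 4 * Real.exp 1 ^ 2 * ((∫ y, |g y| ∂P.μ) * 1) * S * pOv P (hsDiameter σ N)
        ≤ 4 * Real.exp 1 ^ 2 * 1 * S * pOv P (hsDiameter σ N) := by gcongr
      _ = 4 * Real.exp 1 ^ 2 * S * pOv P (hsDiameter σ N) := by ring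
  have hsplit : ∑ j ∈ range J, G j + ∑ j ∈ Ico J N, G j +
      sameBlockRem P (hsDiameter σ N) (N + 1) h2 g g / XiN P σ N (N + 1) -
      (∑ j ∈ range J, T j + ∑' j, T (j + J)) =
      (∑ j ∈ range J, G j - ∑ j ∈ range J, T j) + ∑ j ∈ Ico J N, G j +
        sameBlockRem P (hsDiameter σ N) (N + 1) h2 g g / XiN P σ N (N + 1) - ∑' j, T (j + J) := by
    ring
  rw [hsplit]
  have hx1 := abs_sub (∑ j ∈ range J, G j - ∑ j ∈ range J, T j + ∑ j ∈ Ico J N, G j +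
      sameBlockRem P (hsDiameter σ N) (N + 1) h2 g g / XiN P σ N (N + 1)) (∑' j, T (j + J))
  have hx2 := abs_add_le (∑ j ∈ range J, G j - ∑ j ∈ range J, T j + ∑ j ∈ Ico J N, G j)
      (sameBlockRem P (hsDiameter σ N) (N + 1) h2 g g / XiN P σ N (N + 1))
  have hx3 := abs_add_le (∑ j ∈ range J, G j - ∑ j ∈ range J, T j) (∑ j ∈ Ico J N, G j)
  linarith

/-! ### The variance, uniformly over the unit ball of observables -/

/-- **Uniform variance bound.** `∀ δ > 0, ∀ᶠ N, ∀ g` measurable with `|g| ≤ 1`,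
`Ξ_N(N+1)⁻¹ ∫ ((N+1)⁻¹ ∑ᵢ g(xᵢ) - ∫ g ρ₀)² 𝟙[hard core] dμ^{⊗(N+1)} ≤ δ` (`ρ₀ = rhoLim P σ`; the
variance identity with `I = I(g) = ∫ g ρ₀` and the uniform one- and two-point limits). -/
theorem variance_uniform (hs : SmallDensity P σ) {δ : ℝ} (hδ : 0 < δ) :
    ∀ᶠ N in atTop, ∀ g : T3 → ℝ, Measurable g → (∀ y, |g y| ≤ 1) →
      (∫ x, ((((N + 1 : ℕ) : ℝ))⁻¹ * ∑ i, g (x i) - ∫ y, g y * rhoLim P σ y) ^ 2 *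
          efR (Ov (hsDiameter σ N)) x univ ∂Measure.pi (fun _ : Fin (N + 1) => P.μ)) /
        XiN P σ N (N + 1) ≤ δ := by
  have hθ0 := hs.geomRatio_nonneg
  have hθ1 := hs.geomRatio_lt_one
  set ρm := 2 * Real.exp 1 / (1 - geomRatio P σ) with hρm
  have hρm0 : 0 ≤ ρm := by rw [hρm]; exact div_nonneg (by positivity) (by linarith)
  -- small parameters
  obtain ⟨η₁, hη₁, hη₁le⟩ := LGFS.exists_pos_mul_le (ε := δ / 4) (K := 2 * ρm) (by positivity)
    (by positivity)
  have hE1 := onePt_uniform hs 0 hη₁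
  have hE2 := twoPt_uniform hs (by positivity : (0 : ℝ) < δ / 4)
  have hE3 : ∀ᶠ N : ℕ in atTop, ((N : ℝ) + 1)⁻¹ * (1 + (ρm ^ 2 + δ / 4)) ≤ δ / 4 := by
    have h : Tendsto (fun N : ℕ => ((N : ℝ) + 1)⁻¹ * (1 + (ρm ^ 2 + δ / 4))) atTop (𝓝 0) := by
      have h0 : Tendsto (fun N : ℕ => ((N : ℝ) + 1)⁻¹) atTop (𝓝 0) :=
        tendsto_inv_atTop_zero.comp (tendsto_natCast_atTop_atTop.atTop_add tendsto_const_nhds)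
      simpa using h0.mul_const (1 + (ρm ^ 2 + δ / 4))
    exact (h.eventually (ge_mem_nhds (by positivity : (0 : ℝ) < δ / 4))).mono fun N hN => hN
  have hE4 : ∀ᶠ N : ℕ in atTop, 1 ≤ N := eventually_ge_atTop 1
  filter_upwards [hE1, hE2, hE3, hE4] with N hN1 hN2 hN3 hN4 g hgm hg1
  have hlam1 := hs.ovDensity_lt_one
  have h2 : 2 ≤ N + 1 := by omega
  have hXi := XiN_pos hs.σ_pos.le hs.σ_lt_half hlam1 (N := N) (m := N + 1) le_rfl
  -- centre at `I(g) = ∫ g ρ₀`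
  rw [← Ilim_eq_integral_of_measurable hs hgm hg1]
  -- the variance identity
  rw [XiN, variance_identity P (hsDiameter σ N) h2 hgm hg1 (Ilim P σ g) (by rw [← XiN]; exact hXi.ne')]
  have hq : Md P (hsDiameter σ N) (N + 1) (fun y => g y ^ 2) (N + 1) / Xi P (hsDiameter σ N) (N + 1) (N + 1) =
      onePt P σ (fun y => g y ^ 2) N 0 := by rw [onePt, XiN]; rfl
  have hm' : Md P (hsDiameter σ N) (N + 1) g (N + 1) / Xi P (hsDiameter σ N) (N + 1) (N + 1) =
      onePt P σ g N 0 := by rw [onePt, XiN]; rfl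
  have ht : (∫ q, g (q 0) * g (q ⟨1, h2⟩) * efR (Ov (hsDiameter σ N)) q univ
      ∂Measure.pi (fun _ : Fin (N + 1) => P.μ)) / Xi P (hsDiameter σ N) (N + 1) (N + 1) =
      twoPt P σ g N := by rw [twoPt, dif_pos h2, XiN]
  rw [hq, hm', ht]
  have hn : (((N + 1 : ℕ) : ℝ))⁻¹ = ((N : ℝ) + 1)⁻¹ := by rw [Nat.cast_succ]
  rw [hn]
  have hn0 : 0 ≤ ((N : ℝ) + 1)⁻¹ := by positivity
  -- bounds on the pieces
  have hg2m : Measurable fun y => g y ^ 2 := hgm.pow_const 2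
  have hg2C : ∀ y, |g y ^ 2| ≤ 1 := fun y => by
    rw [abs_pow]; exact pow_le_one₀ (abs_nonneg _) (hg1 y)
  have hsq : |onePt P σ (fun y => g y ^ 2) N 0| ≤ 1 := hs.abs_onePt_le hg2m hg2C N 0
  have hmI : |onePt P σ g N 0 - Ilim P σ g| ≤ η₁ := hN1 g hgm hg1
  have hIle : |Ilim P σ g| ≤ ρm := abs_Ilim_le hs hgm hg1
  have htwo : |twoPt P σ g N - Ilim P σ g ^ 2| ≤ δ / 4 := hN2 g hgm hg1
  have htwoabs : |twoPt P σ g N| ≤ ρm ^ 2 + δ / 4 := by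
    have h := abs_sub_abs_le_abs_sub (twoPt P σ g N) (Ilim P σ g ^ 2)
    have h' : |Ilim P σ g ^ 2| ≤ ρm ^ 2 := by
      rw [abs_pow]; exact pow_le_pow_left₀ (abs_nonneg _) hIle 2
    linarith
  -- conclusion
  have hexpr : ((N : ℝ) + 1)⁻¹ * onePt P σ (fun y => g y ^ 2) N 0 +
      (1 - ((N : ℝ) + 1)⁻¹) * twoPt P σ g N - 2 * Ilim P σ g * onePt P σ g N 0 + Ilim P σ g ^ 2 =
      ((N : ℝ) + 1)⁻¹ * (onePt P σ (fun y => g y ^ 2) N 0 - twoPt P σ g N) +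
        (twoPt P σ g N - Ilim P σ g ^ 2) - 2 * Ilim P σ g * (onePt P σ g N 0 - Ilim P σ g) := by
    ring
  rw [hexpr]
  have hA1 : ((N : ℝ) + 1)⁻¹ * (onePt P σ (fun y => g y ^ 2) N 0 - twoPt P σ g N) ≤ δ / 4 := by
    have hb : onePt P σ (fun y => g y ^ 2) N 0 - twoPt P σ g N ≤ 1 + (ρm ^ 2 + δ / 4) := by
      have hx1 := le_abs_self (onePt P σ (fun y => g y ^ 2) N 0)
      have hx2 := neg_abs_le (twoPt P σ g N)
      linarith
    exact (mul_le_mul_of_nonneg_left hb hn0).trans hN3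
  have hA3 : -(2 * Ilim P σ g * (onePt P σ g N 0 - Ilim P σ g)) ≤ δ / 4 := by
    have h1 : |2 * Ilim P σ g * (onePt P σ g N 0 - Ilim P σ g)| ≤ 2 * ρm * η₁ := by
      rw [abs_mul, abs_mul, abs_two]
      exact mul_le_mul (mul_le_mul_of_nonneg_left hIle zero_le_two) hmI (abs_nonneg _)
        (by positivity)
    have hx := neg_abs_le (2 * Ilim P σ g * (onePt P σ g N 0 - Ilim P σ g))
    linarith
  have hx2 := le_abs_self (twoPt P σ g N - Ilim P σ g ^ 2)
  linarith

/-! ### Stub `stub_oneBodyStatics` (ML) -/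

/-- **ML · `stub_oneBodyStatics`** (line `contact-asymmetry-information`, skeleton v3, crux
`LocalSecondLaw`, stmt-AtomisticToContinuum-13081): the UNIFORM-in-`g` mean-square law of large
numbers for the configurational canonical hard-sphere gas `Ξ⁻¹ · (β dy)^{⊗(N+1)}|_{hard core}` at
small reduced density (`SmallDensity P σ`): for every `ε > 0` there is `N₀` such that for all
`N ≥ N₀` and EVERY measurable `g` with `|g| ≤ 1`,
`Ξ_N(N+1)⁻¹ ∫ ((N+1)⁻¹ ∑ᵢ g(xᵢ) - ∫ g ρ₀)² 𝟙[hard core] dμ^{⊗(N+1)} ≤ ε`, `ρ₀ = rhoLim P σ`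
(Spohn 1991, Part I §2.3 (2.45)–(2.46), made uniform over the unit ball of observables by the
termwise uniform cluster limits `onePt_uniform` / `twoPt_uniform`). -/
theorem stub_oneBodyStatics :
  ∀ (P : DensityProfile) (σ : ℝ), SmallDensity P σ → ∀ ε : ℝ, 0 < ε → ∃ N₀ : ℕ, ∀ N : ℕ, N₀ ≤ N →
    ∀ g : T3 → ℝ, Measurable g → (∀ y, |g y| ≤ 1) →
      (∫ x, ((((N + 1 : ℕ) : ℝ))⁻¹ * ∑ i, g (x i) - ∫ y, g y * rhoLim P σ y) ^ 2 *
          Literature.MathematicalPhysics.StatisticalMechanics.efR (Ov (hsDiameter σ N)) x (Finset.univ : Finset (Fin (N + 1)))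
          ∂Measure.pi (fun _ : Fin (N + 1) => P.μ)) / XiN P σ N (N + 1) ≤ ε := by
  intro P σ hs ε hε
  obtain ⟨N₀, hN₀⟩ := eventually_atTop.1 (variance_uniform hs hε)
  exact ⟨N₀, fun N hN g hgm hg1 => hN₀ N hN g hgm hg1⟩

end LocalSecondLawOneBodyStatics
end Summit.AtomisticToContinuum.HydrodynamicLimit.Theorems
end
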